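import Summits.CriticalPhenomena.PercolationContinuityZ3.Theorems.PercAnnulusCrossingTwoArmsShareCluster
import HarnessLib

/-!
# Two roots, II: the doubly-rooted IIC is Kesten's IIC conditioned on joining the roots (lane RSW3, p1 gen 18)

builds on p205010 (kernel theorem, internal audit signed; external expert review pending) — used only in the `p_c` corollary
(`θ(p_c) = 0`, `CSH.percolationContinuity_allDimensions`); the main theorem takes `θ(p) = 0` as a hypothesis.

RSW3 lane (LANE 3 `prim-rsw3`), seat `prim-rsw3-p1` (gen 18).  Helper file (`--supports stmt-CriticalPhenomena-4575`);
no definitions, no sorries.  Memo `run/shared/lean/prim/rsw3/P1-QM.md` §31.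

`A_n = {0 ↔ ∂ⁱⁿΛ(n) in Λ(n)}`, `B_n(x) = {x ↔ ∂ⁱⁿΛ(n) in Λ(n)}` (part I, `…TwoArmsShareCluster`).

* **`tendsto_real_inter_two_arms_div_oneArmProb`** — under (A2)□ at aspect `(s,L)` and `θ(p) = 0` (`d ≥ 1`, `p > 0`), for every IIC
  probability measure `ν`, every `x`, every local `F`: **`P_p(F ∩ A_n ∩ B_n(x)) / π_p(n) → ν(F ∩ {0 ↔ x})`** (lower bound through the
  cylinders `F ∩ {0 ↔ x in Λ(k)}`; upper bound: part I's BK defect `π(n)π(n−m−1)` and the junk `B_k(x) ∖ {0 ↔ x in Λ(k)}`, whose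
  `ν`-measure vanishes as `k → ∞` by UNIQUENESS OF THE INFINITE CLUSTER under `ν` (gen 5 `iicMeasure_ae_percolatesAt_iff_openConn`));
* **`tendsto_cond_two_arms_iicMeasure`** — **`P_p(E | 0 ↔ ∂ⁱⁿΛ(n), x ↔ ∂ⁱⁿΛ(n)) → ν(E ∩ {0 ↔ x}) / ν(0 ↔ x)`**: THE DOUBLY-ROOTED IIC IS
  KESTEN'S IIC CONDITIONED ON CONTAINING BOTH ROOTS; `…_criticalProbI` — at `p_c(ℤ^d)`, `d ≥ 2`.
References: H. Kesten, PTRF 73 (1986) Thm. (3); D. Basu, A. Sapozhnikov, ECP 22 (2017) Thm. 1.1, §2 (2.4).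
-/

noncomputable section

namespace Summit.CriticalPhenomena.PercolationContinuityZ3.Theorems.Crossing

open MeasureTheory Filter Topology Literature.Probability.Percolation Literature.Probability.LatticeModels
open Literature.Probability.Percolation.DCT16
open Summit.CriticalPhenomena.PercolationContinuityZ3.Theorems.SurfaceTension
open scoped Literature.Probability.Percolation

variable {d : ℕ}

/-- **THE TWO-ROOT RATIO LIMIT**: under (A2)□ at aspect `(s,L)`, `θ(p) = 0` (`d ≥ 1`, `p > 0`, `s ≥ 1`, `ϰ > 0`), for every IIC probability
measure `ν`, every site `x` and every local event `F`: **`P_p(F ∩ A_n ∩ B_n(x)) / π_p(n) → ν(F ∩ {0 ↔ x})`**.  Lower bound through the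
cylinders `F ∩ {0 ↔ x in Λ(k)}`; upper bound: the BK defect `π(n)π(n−m−1)`, and the junk `B_k(x) ∖ {0 ↔ x in Λ(k)}` whose `ν`-measure
vanishes as `k → ∞` by uniqueness of the infinite cluster under `ν` (gen 5). [cite: Kesten1986, Thm. (3)] [cite: BasuSapozhnikov2017ECP, §2 (2.4)] -/
theorem tendsto_real_inter_two_arms_div_oneArmProb (hd : 1 ≤ d) (p : unitInterval) (hp : 0 < (p : ℝ))
    (hθ : theta (zdGraph d) 0 p = 0) {s L : ℕ} (hs : 1 ≤ s) {ϰ : ℝ} (hϰ : 0 < ϰ) (hA2 : SetToSetQuasiMultAspectAt d p s L ϰ)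
    {ν : Measure (BondConfig (Site d))} [IsProbabilityMeasure ν]
    (hν : ∀ (F : Finset (Sym2 (Site d))) (E : Set (BondConfig (Site d))), MeasurableSet E → DeterminedBy E ↑F →
      Tendsto (fun n : ℕ => (bondPercolation (zdGraph d) p).real (E ∩ siteToBoundary d n) / oneArmProb d p n)
        atTop (𝓝 (ν.real E)))
    (x : Site d) {F : Set (BondConfig (Site d))} (hF : IsLocalEvent F) :
    Tendsto (fun n : ℕ => (bondPercolation (zdGraph d) p).real (F ∩ (siteToBoundary d n ∩ {ω : BondConfig (Site d) |
        ∃ t ∈ innerBoundary (zdGraph d) (box d n), ω ∈ openConnIn (↑(box d n) : Set (Site d)) x t})) / oneArmProb d p n)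
      atTop (𝓝 (ν.real (F ∩ openConn 0 x))) := by
  classical
  set μ := bondPercolation (zdGraph d) p with hμ
  set m := Site.supNorm x with hm
  have hxm : x ∈ box d m := mem_box_iff_supNorm_le.2 le_rfl
  set A : ℕ → Set (BondConfig (Site d)) := fun n => siteToBoundary d n with hA
  set B : ℕ → Set (BondConfig (Site d)) := fun n => {ω : BondConfig (Site d) |
    ∃ t ∈ innerBoundary (zdGraph d) (box d n), ω ∈ openConnIn (↑(box d n) : Set (Site d)) x t} with hB
  set C : ℕ → Set (BondConfig (Site d)) := fun n => openConnIn (↑(box d n) : Set (Site d)) 0 x with hC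
  have hπ : ∀ n, 0 < oneArmProb d p n := oneArmProb_pos hd p hp
  have hFm : MeasurableSet F := measurableSet_of_isLocalEvent_holds hF
  have hCloc : ∀ k, IsLocalEvent (C k) := fun k => ⟨(box d k).sym2, determinedBy_openConnIn _ 0 x (by rw [Finset.coe_sym2])⟩
  have hBloc : ∀ k, IsLocalEvent (B k) := fun k => ⟨(box d k).sym2, determinedBy_arm_at k x⟩
  -- monotonicity facts
  have hCmono : ∀ k k', k ≤ k' → C k ⊆ C k' := fun k k' hkk' ω hω =>
    openConnIn_mono (Finset.coe_subset.2 (box_mono d hkk')) _ _ hω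
  have hCAB : ∀ k n, k ≤ n → F ∩ C k ∩ A n ⊆ F ∩ (A n ∩ B n) := by
    rintro k n hkn ω ⟨⟨hωF, hωC⟩, hωA⟩
    obtain ⟨t, ht, h0t⟩ := mem_siteToBoundary_iff.1 hωA
    have hxC : ω ∈ openConnIn (↑(box d n) : Set (Site d)) x 0 :=
      mem_openConnIn_of_pathIn ((pathIn_of_mem_openConnIn (hCmono k n hkn hωC))).symm
    exact ⟨hωF, hωA, t, ht, mem_openConnIn_of_pathIn ((pathIn_of_mem_openConnIn hxC).trans h0t)⟩
  -- (1) the cylinder limits `ℓ_k = ν(F ∩ C_k)` and `ℓ_k → ℓ`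
  have hℓk : ∀ k, Tendsto (fun n : ℕ => μ.real (F ∩ C k ∩ A n) / oneArmProb d p n) atTop (𝓝 (ν.real (F ∩ C k))) :=
    fun k => tendsto_iicMeasure_of_isLocalEvent p hν (hF.inter (hCloc k))
  have hℓ : Tendsto (fun k : ℕ => ν.real (F ∩ C k)) atTop (𝓝 (ν.real (F ∩ openConn 0 x))) := by
    have hmono : Monotone fun k => F ∩ C k := fun k k' hkk' => Set.inter_subset_inter_right _ (hCmono k k' hkk')
    have h := tendsto_measure_iUnion_atTop (μ := ν) hmono
    have hU : (⋃ k, F ∩ C k) = F ∩ openConn 0 x := by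
      rw [← Set.inter_iUnion, ← Literature.Barriers.CriticalPhenomena.openConn_zero_eq_iUnion_openConnIn x]
    rw [hU] at h
    simp only [measureReal_def]
    exact (ENNReal.tendsto_toReal (measure_ne_top ν _)).comp h
  -- (2) the junk `H_k = B_k ∖ C_k` has vanishing IIC-measure
  set H : ℕ → Set (BondConfig (Site d)) := fun i => B (m + 1 + i) \ C (m + 1 + i) with hH
  have hHloc : ∀ i, IsLocalEvent (H i) := fun i => (hBloc _).diff (hCloc _)
  have hHm : ∀ i, MeasurableSet (H i) := fun i => measurableSet_of_isLocalEvent_holds (hHloc i)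
  have hHk : ∀ i, Tendsto (fun n : ℕ => μ.real (H i ∩ A n) / oneArmProb d p n) atTop (𝓝 (ν.real (H i))) :=
    fun i => tendsto_iicMeasure_of_isLocalEvent p hν (hHloc i)
  have hHlim : Tendsto (fun i : ℕ => ν.real (H i)) atTop (𝓝 0) := by
    -- partial intersections and the null intersection
    have hT := tendsto_measure_iInter_le (μ := ν) (f := H) (fun i => (hHm i).nullMeasurableSet) ⟨0, measure_ne_top ν _⟩
    have hnull : ν (⋂ i, H i) = 0 := by
      rw [measure_eq_zero_iff_ae_notMem]
      filter_upwards [iicMeasure_ae_percolatesAt_iff_openConn hd p hp hθ hs hϰ hA2 hν, iicMeasure_ae_subset_edgeSet p hν]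
        with ω hiff hlat hmem
      rw [Set.mem_iInter] at hmem
      have hperc : ω ∈ percolatesAt x := percolatesAt_of_forall_arm_at (k₀ := m + 1) (fun j => (hmem j).1)
      have hconn : ω ∈ (openConn (0 : Site d) x : Set (BondConfig (Site d))) := (hiff x).1 hperc
      rw [Literature.Barriers.CriticalPhenomena.openConn_zero_eq_iUnion_openConnIn x, Set.mem_iUnion] at hconn
      obtain ⟨k, hk⟩ := hconn
      exact (hmem k).2 (hCmono k (m + 1 + k) (by omega) hk)
    rw [hnull] at hT
    have hT' : Tendsto (fun i : ℕ => (ν (⋂ j ≤ i, H j)).toReal) atTop (𝓝 0) := by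
      have h0 := (ENNReal.tendsto_toReal ENNReal.zero_ne_top).comp hT
      rw [ENNReal.toReal_zero] at h0
      exact h0
    refine squeeze_zero' (Eventually.of_forall fun i => measureReal_nonneg) (Eventually.of_forall fun i => ?_) hT'
    -- `ν(H_i) ≤ ν(⋂_{j ≤ i} H_j)`: on lattice configurations `B` is antitone and `C` monotone
    rw [measureReal_def]
    refine ENNReal.toReal_mono (measure_ne_top ν _) (measure_mono_ae ?_)
    filter_upwards [iicMeasure_ae_subset_edgeSet p hν] with ω hlat hωi
    refine Set.mem_iInter₂.2 fun j hji => ⟨?_, fun h' => hωi.2 (hCmono _ _ (by omega) h')⟩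
    -- iterate `arm_at_anti` from `m+1+i` down to `m+1+j`
    have hxk : ∀ k, m + 1 ≤ k → x ∈ box d (k - 1) := fun k hk => box_mono d (by omega) hxm
    have hstep : ∀ t : ℕ, ω ∈ B (m + 1 + j + t) → ω ∈ B (m + 1 + j) := by
      intro t
      induction t with
      | zero => simp
      | succ t ih =>
        intro h'
        refine ih (arm_at_anti (k := m + 1 + j + t) (by omega) (hxk _ (by omega)) hlat ?_)
        rwa [show m + 1 + j + (t + 1) = m + 1 + j + t + 1 by ring] at h'
    exact hstep (i - j) (by rw [show m + 1 + j + (i - j) = m + 1 + i by omega]; exact hωi.1)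
  -- (3) the limit, by the order characterisation
  have hθlim : Tendsto (fun n : ℕ => oneArmProb d p (n - m - 1)) atTop (𝓝 0) := by
    have h := Literature.Probability.Percolation.tendsto_real_siteToBoundary (d := d) p
    rw [hθ] at h
    exact (h.comp (tendsto_sub_atTop_nat (m + 1))).congr (fun n => by simp only [Function.comp_apply, Nat.sub_sub]; rfl)
  have hℓk_le : ∀ k, ν.real (F ∩ C k) ≤ ν.real (F ∩ openConn 0 x) := fun k =>
    measureReal_mono (Set.inter_subset_inter_right _ (by
      rw [Literature.Barriers.CriticalPhenomena.openConn_zero_eq_iUnion_openConnIn x]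
      exact Set.subset_iUnion (fun n : ℕ => (openConnIn (↑(box d n) : Set (Site d)) (0 : Site d) x : Set (BondConfig (Site d)))) k))
  rw [tendsto_order]
  refine ⟨fun b hb => ?_, fun b hb => ?_⟩
  · -- lower bound: some cylinder `F ∩ C_k` already has `ν`-measure `> b`
    obtain ⟨k, hk⟩ := (eventually_atTop.1 ((tendsto_order.1 hℓ).1 b hb))
    have hk' := hk k le_rfl
    filter_upwards [(tendsto_order.1 (hℓk k)).1 b hk', eventually_ge_atTop k] with n hn hnk
    exact lt_of_lt_of_le hn (div_le_div_of_nonneg_right (measureReal_mono (hCAB k n hnk)) (hπ n).le)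
  · -- upper bound
    set ℓ := ν.real (F ∩ openConn 0 x) with hℓdef
    have hε : 0 < (b - ℓ) / 5 := by linarith
    obtain ⟨i, hi⟩ := eventually_atTop.1 ((tendsto_order.1 hHlim).2 _ hε)
    set k := m + 1 + i with hk
    have h1 := (tendsto_order.1 (hℓk k)).2 (ℓ + (b - ℓ) / 5) (by linarith [hℓk_le k])
    have h2 := (tendsto_order.1 (hHk i)).2 (2 * ((b - ℓ) / 5)) (by linarith [hi i le_rfl])
    have h3 := (tendsto_order.1 hθlim).2 _ hε
    filter_upwards [h1, h2, h3, eventually_ge_atTop (max k (m + 2))] with n hn1 hn2 hn3 hn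
    have hnk : k ≤ n := le_trans (le_max_left _ _) hn
    have hnm : m + 1 < n := lt_of_lt_of_le (by omega) (le_trans (le_max_right _ _) hn)
    -- the decomposition `F ∩ A ∩ B ⊆ (F ∩ C_k ∩ A) ∪ (H_i ∩ A) ∪ (A ∩ B ∖ C_n)` on lattice configurations
    have hle : μ.real (F ∩ (A n ∩ B n)) ≤
        μ.real (F ∩ C k ∩ A n) + μ.real (H i ∩ A n) + μ.real ((A n ∩ B n) \ C n) := by
      refine (real_mono_of_forall_subset_edgeSet (zdGraph d) p (B := (F ∩ C k ∩ A n) ∪ (H i ∩ A n) ∪ ((A n ∩ B n) \ C n))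
        fun ω hlat hω => ?_).trans ((measureReal_union_le _ _).trans (add_le_add_left (measureReal_union_le _ _) _))
      obtain ⟨hωF, hωA, hωB⟩ := hω
      by_cases hCn : ω ∈ C n
      · by_cases hCk : ω ∈ C k
        · exact Or.inl (Or.inl ⟨⟨hωF, hCk⟩, hωA⟩)
        · exact Or.inl (Or.inr ⟨⟨arm_at_of_openConnIn_of_not (k := k) (by omega) (box_mono d (by omega) hxm) hlat hCn hCk, hCk⟩,
            hωA⟩)
      · exact Or.inr ⟨⟨hωA, hωB⟩, hCn⟩
    have hdiff : μ.real ((A n ∩ B n) \ C n) ≤ oneArmProb d p n * oneArmProb d p (n - m - 1) :=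
      (real_arm_inter_arm_diff_le p (box_mono d (by omega) hxm)).trans
        (mul_le_mul_of_nonneg_left (real_arm_at_le_oneArmProb p (by omega) hxm) (hπ n).le)
    have hπn := hπ n
    calc μ.real (F ∩ (A n ∩ B n)) / oneArmProb d p n
        ≤ (μ.real (F ∩ C k ∩ A n) + μ.real (H i ∩ A n) + oneArmProb d p n * oneArmProb d p (n - m - 1)) /
            oneArmProb d p n := div_le_div_of_nonneg_right (hle.trans (by linarith)) hπn.le
      _ = μ.real (F ∩ C k ∩ A n) / oneArmProb d p n + μ.real (H i ∩ A n) / oneArmProb d p n +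
            oneArmProb d p (n - m - 1) := by field_simp
      _ < ℓ + (b - ℓ) / 5 + 2 * ((b - ℓ) / 5) + (b - ℓ) / 5 := by linarith
      _ ≤ b := by linarith

/-- **THE DOUBLY-ROOTED IIC IS KESTEN'S IIC CONDITIONED ON CONTAINING BOTH ROOTS**: under (A2)□ at aspect `(s,L)` and `θ(p) = 0`
(`d ≥ 1`, `p > 0`, `s ≥ 1`, `ϰ > 0`), for every IIC probability measure `ν`, every site `x` and every local event `E`:
**`P_p(E | 0 ↔ ∂ⁱⁿΛ(n), x ↔ ∂ⁱⁿΛ(n)) → ν(E ∩ {0 ↔ x}) / ν(0 ↔ x)`** (`ν(0 ↔ x) ≥ τ_p(0,x) > 0`, gen 5).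
[cite: Kesten1986, Thm. (3)] [cite: BasuSapozhnikov2017ECP, Thm. 1.1] -/
theorem tendsto_cond_two_arms_iicMeasure (hd : 1 ≤ d) (p : unitInterval) (hp : 0 < (p : ℝ))
    (hθ : theta (zdGraph d) 0 p = 0) {s L : ℕ} (hs : 1 ≤ s) {ϰ : ℝ} (hϰ : 0 < ϰ) (hA2 : SetToSetQuasiMultAspectAt d p s L ϰ)
    {ν : Measure (BondConfig (Site d))} [IsProbabilityMeasure ν]
    (hν : ∀ (F : Finset (Sym2 (Site d))) (E : Set (BondConfig (Site d))), MeasurableSet E → DeterminedBy E ↑F →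
      Tendsto (fun n : ℕ => (bondPercolation (zdGraph d) p).real (E ∩ siteToBoundary d n) / oneArmProb d p n)
        atTop (𝓝 (ν.real E)))
    (x : Site d) {E : Set (BondConfig (Site d))} (hE : IsLocalEvent E) :
    Tendsto (fun n : ℕ => (bondPercolation (zdGraph d) p).real (E ∩ (siteToBoundary d n ∩ {ω : BondConfig (Site d) |
        ∃ t ∈ innerBoundary (zdGraph d) (box d n), ω ∈ openConnIn (↑(box d n) : Set (Site d)) x t})) /
      (bondPercolation (zdGraph d) p).real (siteToBoundary d n ∩ {ω : BondConfig (Site d) |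
        ∃ t ∈ innerBoundary (zdGraph d) (box d n), ω ∈ openConnIn (↑(box d n) : Set (Site d)) x t}))
      atTop (𝓝 (ν.real (E ∩ openConn 0 x) / ν.real (openConn 0 x))) := by
  have hπ : ∀ n, 0 < oneArmProb d p n := oneArmProb_pos hd p hp
  have hnum := tendsto_real_inter_two_arms_div_oneArmProb hd p hp hθ hs hϰ hA2 hν x hE
  have hden := tendsto_real_inter_two_arms_div_oneArmProb hd p hp hθ hs hϰ hA2 hν x
    (F := Set.univ) ⟨∅, fun _ _ _ => by simp⟩
  simp only [Set.univ_inter] at hden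
  have hpos : ν.real (openConn 0 x) ≠ 0 := (iicMeasure_real_openConn_pos hd p hp hν x).ne'
  refine ((hnum.div hden hpos)).congr fun n => ?_
  simp only [Pi.div_apply]
  rw [div_div_div_cancel_right₀ (hπ n).ne']

/-- **At `p_c(ℤ^d)`** (`d ≥ 2`, (A2)□ at aspect `(s,L)`, `s ≥ 1`, `ϰ > 0`; `θ(p_c) = 0` is the tree theorem p205010): for every IIC
probability measure `ν`, every `x` and every local `E`, `P_{p_c}(E | 0 ↔ ∂ⁱⁿΛ(n), x ↔ ∂ⁱⁿΛ(n)) → ν(E ∩ {0 ↔ x}) / ν(0 ↔ x)`, and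
`P_{p_c}(0 ↔ x in Λ(n) | 0 ↔ ∂ⁱⁿΛ(n), x ↔ ∂ⁱⁿΛ(n)) → 1` (the latter needs no (A2)□). [cite: Kesten1986, Thm. (3)]
[cite: BasuSapozhnikov2017ECP, Thm. 1.1] -/
theorem tendsto_cond_two_arms_iicMeasure_criticalProbI (hd : 2 ≤ d) {s L : ℕ} (hs : 1 ≤ s) {ϰ : ℝ} (hϰ : 0 < ϰ)
    (hA2 : SetToSetQuasiMultAspectAt d (criticalProbI d) s L ϰ)
    {ν : Measure (BondConfig (Site d))} [IsProbabilityMeasure ν]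
    (hν : ∀ (F : Finset (Sym2 (Site d))) (E : Set (BondConfig (Site d))), MeasurableSet E → DeterminedBy E ↑F →
      Tendsto (fun n : ℕ => (bondPercolation (zdGraph d) (criticalProbI d)).real (E ∩ siteToBoundary d n) /
        oneArmProb d (criticalProbI d) n) atTop (𝓝 (ν.real E)))
    (x : Site d) {E : Set (BondConfig (Site d))} (hE : IsLocalEvent E) :
    Tendsto (fun n : ℕ => (bondPercolation (zdGraph d) (criticalProbI d)).real (E ∩ (siteToBoundary d n ∩ {ω : BondConfig (Site d) |
        ∃ t ∈ innerBoundary (zdGraph d) (box d n), ω ∈ openConnIn (↑(box d n) : Set (Site d)) x t})) /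
      (bondPercolation (zdGraph d) (criticalProbI d)).real (siteToBoundary d n ∩ {ω : BondConfig (Site d) |
        ∃ t ∈ innerBoundary (zdGraph d) (box d n), ω ∈ openConnIn (↑(box d n) : Set (Site d)) x t}))
      atTop (𝓝 (ν.real (E ∩ openConn 0 x) / ν.real (openConn 0 x))) := by
  have hd1 : 1 ≤ d := le_trans (by norm_num) hd
  have hp : 0 < ((criticalProbI d : unitInterval) : ℝ) := by
    rw [coe_criticalProbI]; exact criticalProb_zd_pos d hd1
  exact tendsto_cond_two_arms_iicMeasure hd1 _ hp (CSH.percolationContinuity_allDimensions d hd) hs hϰ hA2 hν x hE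

end Summit.CriticalPhenomena.PercolationContinuityZ3.Theorems.Crossing

end
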